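import Summits.CriticalPhenomena.PercolationContinuityZ3.Theorems.FK.InfiniteVolumeFiniteEnergy
import Literature.Probability.Percolation.LocalLimitConnections
import Literature.Probability.LatticeModels.DoubleCurrentsProofs
import Literature.Probability.Percolation.LocalEvents
import HarnessLib

/-!
# FK-continuity transplant, FO-06 (construction half): one-edge DLR property of the box limits —
# transport through the lift, the exit lemma, locality (Grimmett 2006, Lemma (4.39), one edge)

Cell `fk-continuity` (bschramm), row FO-06b-5; support file for the FK-continuity transplant
(`--supports stmt-CriticalPhenomena-4575`); builds on p205010 (kernel theorem, internal audit signed;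
external expert review pending). No named facts, no sorries, standard axioms. General dimension `d`,
both boundary conditions `b`.

Deterministic and measure-free preliminaries for the one-edge DLR equations (Grimmett 2006,
Prop. (4.37) eq. (4.38), proved for the box limits `φ^b_{p,q}` in `InfiniteVolumeOneEdgeDLR.lean` /
`InfiniteVolumeOneEdgeDLRClosed.lean`):

* transport of one lattice edge `e = s(x,y)` and of events determined off `e` through the lift
  `liftEdges (box d n)` (`mk_mem_liftEdges_iff`, `liftEdges_insert_mk`, `liftEdges_diff_singleton_mk`,
  `insert_mem_preimage_liftEdges_iff`);
* **the exit lemma** `exists_exit_of_reachable_sup_wired` — the combinatorial step of Grimmett's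
  Lemma (4.39) for one edge: in the box `Λ_n` with wired set outside `Λ_m`, if `z ∈ Λ_m` is joined to
  `w` by open edges and wired jumps but the lifted configuration does not join them inside `Λ_m`,
  then it joins `z` inside `Λ_{m+1}` to a site of `Λ_{m+1} ∖ Λ_m` (first boundary dart of the path);
* locality of the exit event and of the events `{e open} ∩ H ∩ (· ∖ e)⁻¹ A` (`isLocalEvent_exit`, …).

## References

* G. Grimmett, *The Random-Cluster Model*, Springer 2006: §4.2 (4.11)–(4.12); Lemma (4.39) and its
  proof, eq. (4.40)–(4.41), p. 83. [Grimmett2006]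
-/

noncomputable section

open MeasureTheory Set Filter
open scoped Topology ENNReal

namespace Summit.CriticalPhenomena.PercolationContinuityZ3.Theorems.FK

open Literature.Probability.Percolation Literature.Probability.LatticeModels

variable {d : ℕ}

/-! ### Transport through the lift `liftEdges (box d n)` -/

section Transport

variable {n : ℕ}

/-- The lift is injective on edges: `s(x,y) ∈ liftEdges Λ_n ω ↔ s(⟨x⟩,⟨y⟩) ∈ ω`. [cite: Grimmett2006, §4.2 (configurations on E_Λ)] -/
theorem mk_mem_liftEdges_iff {x y : Site d} (hx : x ∈ box d n) (hy : y ∈ box d n)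
    (ω : BondConfig ↥(box d n)) :
    s(x, y) ∈ liftEdges (box d n) ω ↔ s((⟨x, hx⟩ : ↥(box d n)), ⟨y, hy⟩) ∈ ω := by
  have hinj : Function.Injective (Sym2.map (Subtype.val : ↥(box d n) → Site d)) :=
    Sym2.map.injective Subtype.val_injective
  have h : s(x, y) = Sym2.map Subtype.val s((⟨x, hx⟩ : ↥(box d n)), ⟨y, hy⟩) := by rw [Sym2.map_mk]
  rw [h, liftEdges, hinj.mem_set_image]

/-- The lift commutes with opening one edge of the box. [cite: Grimmett2006, §4.2] -/
theorem liftEdges_insert_mk {x y : Site d} (hx : x ∈ box d n) (hy : y ∈ box d n)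
    (ω : BondConfig ↥(box d n)) :
    liftEdges (box d n) (insert s((⟨x, hx⟩ : ↥(box d n)), ⟨y, hy⟩) ω) =
      insert s(x, y) (liftEdges (box d n) ω) := by
  rw [liftEdges, liftEdges, Set.image_insert_eq, Sym2.map_mk]

/-- The lift commutes with closing one edge of the box. [cite: Grimmett2006, §4.2] -/
theorem liftEdges_diff_singleton_mk {x y : Site d} (hx : x ∈ box d n) (hy : y ∈ box d n)
    (ω : BondConfig ↥(box d n)) :
    liftEdges (box d n) (ω \ {s((⟨x, hx⟩ : ↥(box d n)), ⟨y, hy⟩)}) =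
      liftEdges (box d n) ω \ {s(x, y)} := by
  have hinj : Function.Injective (Sym2.map (Subtype.val : ↥(box d n) → Site d)) :=
    Sym2.map.injective Subtype.val_injective
  rw [liftEdges, liftEdges, Set.image_sdiff hinj, Set.image_singleton, Sym2.map_mk]

/-- Pull-back of `{e open} ∩ X` along the lift: `{e' open} ∩ (lift⁻¹ X)`. [cite: Grimmett2006, §4.2] -/
theorem liftEdges_preimage_setOf_mem_inter {x y : Site d} (hx : x ∈ box d n) (hy : y ∈ box d n)
    (X : Set (BondConfig (Site d))) :
    liftEdges (box d n) ⁻¹' ({ω | s(x, y) ∈ ω} ∩ X) =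
      liftEdges (box d n) ⁻¹' X ∩ {ω | s((⟨x, hx⟩ : ↥(box d n)), ⟨y, hy⟩) ∈ ω} := by
  ext ω
  simp only [Set.mem_preimage, Set.mem_inter_iff, Set.mem_setOf_eq, mk_mem_liftEdges_iff hx hy]
  exact and_comm

/-- An event of `ℤ^d` determined by pairs other than `e = s(x,y)` pulls back to an event of the box
determined off the copy of `e`. [cite: Grimmett2006, §4.2] -/
theorem insert_mem_preimage_liftEdges_iff {x y : Site d} (hx : x ∈ box d n) (hy : y ∈ box d n)
    {X : Set (BondConfig (Site d))} (hX : ∀ ω, insert s(x, y) ω ∈ X ↔ ω ∈ X)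
    (ω : BondConfig ↥(box d n)) :
    insert s((⟨x, hx⟩ : ↥(box d n)), ⟨y, hy⟩) ω ∈ liftEdges (box d n) ⁻¹' X ↔
      ω ∈ liftEdges (box d n) ⁻¹' X := by
  rw [Set.mem_preimage, Set.mem_preimage, liftEdges_insert_mk hx hy, hX]

/-- An event determined by a set of pairs not containing `e` is invariant under opening `e`. [folklore] -/
theorem insert_mem_iff_of_determinedBy {ι : Type*} {A : Set (Set ι)} {F : Set ι} (hA : DeterminedBy A F)
    {i : ι} (hi : i ∉ F) (ω : Set ι) : insert i ω ∈ A ↔ ω ∈ A := by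
  refine (determinedBy_iff A F).1 hA _ _ ?_
  ext j
  simp only [Set.mem_inter_iff, Set.mem_insert_iff]
  constructor
  · rintro ⟨rfl | h, hj⟩
    · exact (hi hj).elim
    · exact ⟨h, hj⟩
  · rintro ⟨h, hj⟩
    exact ⟨Or.inr h, hj⟩

/-- A pull-back `(· ∖ {i}) ⁻¹' A` is invariant under opening `i`. [folklore] -/
theorem insert_mem_preimage_diff_singleton_iff {ι : Type*} (A : Set (Set ι)) (i : ι) (ω : Set ι) :
    insert i ω ∈ (fun η : Set ι => η \ {i}) ⁻¹' A ↔ ω ∈ (fun η : Set ι => η \ {i}) ⁻¹' A := by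
  simp only [Set.mem_preimage, Set.insert_sdiff_of_mem _ (Set.mem_singleton i)]

end Transport

/-! ### The deterministic heart of Lemma (4.39): joined far away, not joined nearby ⇒ both exit -/

section Exit

/-- The vertices of the wired boundary `∂Λ_n` lie outside every smaller box `Λ_m`, `m < n`. [cite: Grimmett2006, §4.2 (4.11)–(4.12)] -/
theorem not_mem_box_of_mem_boxBC {b : Bool} {n m : ℕ} (hmn : m + 1 ≤ n) {c : ↥(box d n)}
    (hc : c ∈ boxBC d b n) : (c : Site d) ∉ box d m := by
  cases b
  · simp [boxBC] at hc
  · simp only [boxBC, cond_true, mem_wiredBoundary_iff, mem_innerBoundary_iff] at hc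
    obtain ⟨-, z, hz, hadj⟩ := hc
    intro hcm
    exact hz (box_mono d hmn (mem_box_succ_of_zdGraph_adj d hcm hadj))

/-- **Exit lemma** (the combinatorial step of Grimmett's Lemma (4.39), for one edge): in the box
`Λ_n` with wired set `B` outside `Λ_m`, if `z` (in `Λ_m`) is joined to `w` by a path of open edges of
`ω₀` and wired jumps, but the lifted configuration does NOT join `z` to `w` inside `Λ_m`, then the
lifted configuration joins `z` inside `Λ_{m+1}` to a site of `Λ_{m+1} ∖ Λ_m` (the path must leave
`Λ_m` through an open lattice edge before it can reach `w` or the wired set).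
[cite: Grimmett2006, Lemma (4.39) and its proof, p. 83] -/
theorem exists_exit_of_reachable_sup_wired {n m : ℕ} {B : Set ↥(box d n)}
    (hB : ∀ c ∈ B, (c : Site d) ∉ box d m) {ω₀ : BondConfig ↥(box d n)}
    (hω₀ : ω₀ ⊆ (finsetGraph (zdGraph d) (box d n)).edgeSet) {z w : ↥(box d n)}
    (hz : (z : Site d) ∈ box d m) (hreach : (openGraph ω₀ ⊔ wired B).Reachable z w)
    (hnot : liftEdges (box d n) ω₀ ∉
      openConnVia (withinGraph ⊤ (↑(box d m) : Set (Site d))) (z : Site d) (w : Site d)) :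
    ∃ b ∈ box d (m + 1), b ∉ box d m ∧ liftEdges (box d n) ω₀ ∈
      openConnVia (withinGraph ⊤ (↑(box d (m + 1)) : Set (Site d))) (z : Site d) b := by
  classical
  set η := liftEdges (box d n) ω₀ with hη
  obtain ⟨p⟩ := hreach
  -- the vertices joined to `z` inside `Λ_m`
  set S : Set ↥(box d n) :=
    {c | η ∈ openConnVia (withinGraph ⊤ (↑(box d m) : Set (Site d))) (z : Site d) (c : Site d)} with hS
  have hzS : z ∈ S := self_mem_openClusterIn _ η (z : Site d)
  obtain ⟨dt, -, haS, hbS⟩ := p.exists_boundary_dart S hzS hnot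
  set a := dt.toProd.1
  set b := dt.toProd.2
  have haz : (a : Site d) ∈ openClusterIn (withinGraph ⊤ (↑(box d m) : Set (Site d))) η (z : Site d) := haS
  have ham : (a : Site d) ∈ box d m := by
    have := openClusterIn_withinGraph_subset (G := (⊤ : SimpleGraph (Site d))) (Finset.mem_coe.2 hz) η haz
    exact Finset.mem_coe.1 this
  rcases (SimpleGraph.sup_adj _ _ _ _).1 dt.adj with hopen | hwired
  · -- an open lattice edge `s(a,b) ∈ ω₀`
    rw [openGraph_adj] at hopen
    obtain ⟨hab, hne⟩ := hopen
    have hadj : (zdGraph d).Adj (a : Site d) (b : Site d) := by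
      have := hω₀ hab
      rwa [SimpleGraph.mem_edgeSet, finsetGraph_adj_iff] at this
    have hne' : (a : Site d) ≠ (b : Site d) := fun h => hne (Subtype.ext h)
    have hmem : s((a : Site d), (b : Site d)) ∈ η := ⟨s(a, b), hab, by rw [Sym2.map_mk]⟩
    have hbm : (b : Site d) ∉ box d m := by
      intro hbm
      refine hbS (mem_openClusterIn_of_adj haz ?_ hmem)
      exact ⟨(SimpleGraph.top_adj _ _).2 hne', Finset.mem_coe.2 ham, Finset.mem_coe.2 hbm⟩
    refine ⟨(b : Site d), mem_box_succ_of_zdGraph_adj d ham hadj, hbm, ?_⟩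
    have haz' : (a : Site d) ∈ openClusterIn (withinGraph ⊤ (↑(box d (m + 1)) : Set (Site d))) η (z : Site d) :=
      openClusterIn_mono_graph (withinGraph_mono ⊤ (Finset.coe_subset.2 (box_mono d (Nat.le_succ m))))
        η _ haz
    refine mem_openClusterIn_of_adj haz' ?_ hmem
    exact ⟨(SimpleGraph.top_adj _ _).2 hne', Finset.mem_coe.2 (box_mono d (Nat.le_succ m) ham),
      Finset.mem_coe.2 (mem_box_succ_of_zdGraph_adj d ham hadj)⟩
  · -- a wired jump starts in `B`, but `a ∈ Λ_m`
    rw [wired_adj] at hwired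
    exact (hB a hwired.2.1 ham).elim

end Exit

/-! ### Locality of the events involved -/

section Locality

/-- **The exit event is local**: `{z is joined inside Λ_{m+1} to a site of Λ_{m+1} ∖ Λ_m}` is
determined by the pairs of sites of `Λ_{m+1}`. [folklore] -/
theorem isLocalEvent_exit (m : ℕ) (z : Site d) :
    IsLocalEvent {ω : BondConfig (Site d) | ∃ b ∈ box d (m + 1), b ∉ box d m ∧
      ω ∈ openConnVia (withinGraph ⊤ (↑(box d (m + 1)) : Set (Site d))) z b} := by
  refine ⟨(box d (m + 1)).sym2, ?_⟩
  have hsub : (withinGraph ⊤ (↑(box d (m + 1)) : Set (Site d))).edgeSet ⊆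
      (↑((box d (m + 1)).sym2) : Set (Sym2 (Site d))) := by
    intro e he
    induction e using Sym2.ind with
    | _ u v =>
      have h := mem_edgeSet_withinGraph.1 he
      rw [Finset.mem_coe, Finset.mk_mem_sym2_iff]
      exact ⟨h.2.1, h.2.2⟩
  rw [determinedBy_iff]
  intro ω ω' hωω'
  simp only [Set.mem_setOf_eq]
  refine exists_congr fun b => and_congr_right fun _ => and_congr_right fun _ => ?_
  exact (determinedBy_iff _ _).1 ((determinedBy_openConnVia _ z b).mono hsub) ω ω' hωω'

/-- `{e open} ∩ H ∩ (· ∖ {e})⁻¹ A` is local for local `H`, `A`. [folklore] -/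
theorem isLocalEvent_setOf_mem_inter_inter_preimage (e : Sym2 (Site d)) {H A : Set (BondConfig (Site d))}
    (hH : IsLocalEvent H) (hA : IsLocalEvent A) :
    IsLocalEvent ({ω : BondConfig (Site d) | e ∈ ω} ∩ H ∩ (fun η => η \ {e}) ⁻¹' A) := by
  classical
  obtain ⟨F, hF⟩ := hH
  obtain ⟨G, hG⟩ := isLocalEvent_preimage_sdiff hA {e}
  refine ⟨{e} ∪ F ∪ G, ?_⟩
  rw [Finset.coe_union, Finset.coe_union, Finset.coe_singleton]
  exact (((determinedBy_mem e).mono (Set.subset_union_left.trans Set.subset_union_left)).inter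
    (hF.mono (Set.subset_union_right.trans Set.subset_union_left))).inter (hG.mono Set.subset_union_right)

/-- `H ∩ (· ∖ {e})⁻¹ A` is local for local `H`, `A`. [folklore] -/
theorem isLocalEvent_inter_preimage (e : Sym2 (Site d)) {H A : Set (BondConfig (Site d))}
    (hH : IsLocalEvent H) (hA : IsLocalEvent A) :
    IsLocalEvent (H ∩ (fun η => η \ {e}) ⁻¹' A) := by
  classical
  obtain ⟨F, hF⟩ := hH
  obtain ⟨G, hG⟩ := isLocalEvent_preimage_sdiff hA {e}
  refine ⟨F ∪ G, ?_⟩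
  rw [Finset.coe_union]
  exact (hF.mono Set.subset_union_left).inter (hG.mono Set.subset_union_right)

end Locality

end Summit.CriticalPhenomena.PercolationContinuityZ3.Theorems.FK

end
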